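import Summits.QuantumFields.QCD.Theorems.PauliWegnerSeaChiralGluonicCompletionStubSecondMomentOfFmChiralTwo
import Summits.QuantumFields.QCD.Theorems.PauliWegnerSeaChiralGluonicCompletionStubGoldstoneOfSecondMomentTwo
import Summits.QuantumFields.QCD.Theorems.PauliWegnerSeaChiralOneScaleTrajectoryJensenPointwise

/-!
# Crux `ChiralGluonicCompletion` (stmt-QuantumFields-17498), line `Sketch` — where E* is FREE at `N_f = 2`:
# clause (iii) at a degenerate tuple with constants `(s, C₁)` gives the Goldstone bound at every rate above `2C₁/s`
# (statement probe; per-rate reading of the cycle-2 chain p135565 → p135713)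

`stub_hasGoldstoneBoundAt_two_of_clauseIII`: the PER-RATE reading of the landed chain
`stub_secondMoment_of_fmChiral_two` (p135565) → `stub_goldstone_of_secondMoment_two` (p135713).  Both landed
theorems are stated as `∀ ε > 0, ∃ m > 0, …` chains, but their proofs work one rate at a time and never use
`0 < ε`; here the two per-rate cores are isolated:

* `secondMomentAt_of_clauseIIIAt_two` — clause (iii) at ONE degenerate tuple `(m, m)` with exposed constants
  `(0 < s ≤ 2, c₀ > 0, C₁, p)` gives the `|det|`-weighted SECOND-moment lower bound with rate `2C₁/s`, constant
  `c₀^{2/s}/144` and log-loss `2p/s`, pointwise in `(k, S, n)` through the filter-free Jensen/Cauchy–Schwarz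
  inequality `(E₊[X^s])^{2/s} ≤ 144 · E₊[Σ|G_f|²]` (`…GoldstoneWitness.fm_rpow_le_secondMoment_two`, crux 17512);
* `hasGoldstoneBoundAt_of_secondMomentAt_two` — a second-moment lower bound at ONE positive degenerate tuple with
  rate `μ` gives `reg.HasGoldstoneBoundAt ε` at every `ε > μ` (verbatim the body of p135713: the other flavour,
  the charged pion pair, `det D = |det D|` at two degenerate flavours, separations absorbing the log-loss).
Folklore bookkeeping; no new cited facts.
-/

noncomputable section

namespace Summit.QuantumFields.QCD.Theorems.StronglyChiralSubsequence

open MeasureTheory Filter Topology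
open Literature.MathematicalPhysics.QuantumFieldTheory Literature.MathematicalPhysics.QuantumLattice
  Literature.Probability.LatticeModels
open Summit.QuantumFields.QCD.Cruxes.ChiralOneScaleTrajectory.GoldstoneWitness

/-- **Per-rate Jensen step (`N_f = 2`).**  An eventual `|det|`-weighted FRACTIONAL-moment lower bound
`c₀ e^{−(C₁ a_k n + p log(n+1))} ≤ E₊[X^s]` (`X = Σ_{a,i,b,j}|G_f((0,a,i),(ne₀,b,j))|`, `0 < s ≤ 2`) at the degenerate
bare tuple `m_crit(k) + a_k m / Z_m(k)`, on all tori `S ≥ L_k` and separations `n ≤ S`, is an eventual lower bound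
`(c₀^{2/s}/144) e^{−((2C₁/s) a_k n + (2p/s) log(n+1))} ≤ E₊[Σ|G_f|²]` for the `|det|`-weighted SECOND moment:
raise `c₀ e^{−(…)} ≤ E₊[X^s]` to the power `2/s` and use `(E₊[X^s])^{2/s} ≤ 144 · E₊[Σ|G_f|²]`
(`…GoldstoneWitness.fm_rpow_le_secondMoment_two`: Cauchy–Schwarz over the `144` colour–spin pairs and Jensen under
the phase-quenched probability measure).  The per-rate core of `stub_secondMoment_of_fmChiral_two` (p135565); no
sign condition on `C₁`, no rate `ε`. [folklore] -/
theorem secondMomentAt_of_clauseIIIAt_two (reg : QCDRegularisation 2) (m : ℝ) (f : Fin 2) {s c₀ : ℝ}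
    (C₁ p : ℝ) (hs : 0 < s) (hs2 : s ≤ 2) (hc₀ : 0 < c₀)
    (hev : ∀ᶠ k in atTop, ∀ S : ℕ, reg.L k ≤ S → ∀ n : ℕ, n ≤ S →
      c₀ * Real.exp (-(C₁ * (reg.a k * n) + p * Real.log (n + 1))) ≤
        (∫ U : GaugeConfig 4 (2 * S + 1) (Matrix.specialUnitaryGroup (Fin 3) ℂ),
            ‖(diracMatrix U fun _ : Fin 2 => reg.mcrit k + reg.a k * m / reg.Zm k).det‖ *
              (∑ a : Fin 3, ∑ i : Fin 4, ∑ b : Fin 3, ∑ j : Fin 4,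
                ‖(diracMatrix U fun _ : Fin 2 => reg.mcrit k + reg.a k * m / reg.Zm k)⁻¹
                    (quarkEquiv (f, (Torus.proj (2 * S + 1) 0, a, i)))
                    (quarkEquiv (f, (Torus.proj (2 * S + 1) (Pi.single 0 (n : ℤ)), b, j)))‖) ^ s
            ∂(wilsonMeasure (fundamentalRep (Fin 3)) (reg.β k))) /
          (∫ U : GaugeConfig 4 (2 * S + 1) (Matrix.specialUnitaryGroup (Fin 3) ℂ),
            ‖(diracMatrix U fun _ : Fin 2 => reg.mcrit k + reg.a k * m / reg.Zm k).det‖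
              ∂(wilsonMeasure (fundamentalRep (Fin 3)) (reg.β k)))) :
    ∀ᶠ k in atTop, ∀ S : ℕ, reg.L k ≤ S → ∀ n : ℕ, n ≤ S →
      c₀ ^ (2 / s) / 144 * Real.exp (-(2 * C₁ / s * (reg.a k * n) + 2 * p / s * Real.log (n + 1))) ≤
        (∫ U : GaugeConfig 4 (2 * S + 1) (Matrix.specialUnitaryGroup (Fin 3) ℂ),
            ‖(diracMatrix U fun _ : Fin 2 => reg.mcrit k + reg.a k * m / reg.Zm k).det‖ *
              (∑ a : Fin 3, ∑ i : Fin 4, ∑ b : Fin 3, ∑ j : Fin 4,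
                ‖(diracMatrix U fun _ : Fin 2 => reg.mcrit k + reg.a k * m / reg.Zm k)⁻¹
                    (quarkEquiv (f, (Torus.proj (2 * S + 1) 0, a, i)))
                    (quarkEquiv (f, (Torus.proj (2 * S + 1) (Pi.single 0 (n : ℤ)), b, j)))‖ ^ (2 : ℕ))
            ∂(wilsonMeasure (fundamentalRep (Fin 3)) (reg.β k))) /
          (∫ U : GaugeConfig 4 (2 * S + 1) (Matrix.specialUnitaryGroup (Fin 3) ℂ),
            ‖(diracMatrix U fun _ : Fin 2 => reg.mcrit k + reg.a k * m / reg.Zm k).det‖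
              ∂(wilsonMeasure (fundamentalRep (Fin 3)) (reg.β k))) := by
  filter_upwards [hev] with k hk S hS n hn
  have hlow := hk S hS n hn
  have hpt := fm_rpow_le_secondMoment_two (2 * S + 1) (reg.β k) (reg.mcrit k + reg.a k * m / reg.Zm k) s hs
    hs2 f (Torus.proj (2 * S + 1) 0) (Torus.proj (2 * S + 1) (Pi.single 0 (n : ℤ)))
  -- abbreviate the two quotients
  set FM : ℝ := (∫ U : GaugeConfig 4 (2 * S + 1) (Matrix.specialUnitaryGroup (Fin 3) ℂ),
      ‖(diracMatrix U fun _ : Fin 2 => reg.mcrit k + reg.a k * m / reg.Zm k).det‖ *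
        (∑ a : Fin 3, ∑ i : Fin 4, ∑ b : Fin 3, ∑ j : Fin 4,
          ‖(diracMatrix U fun _ : Fin 2 => reg.mcrit k + reg.a k * m / reg.Zm k)⁻¹
              (quarkEquiv (f, (Torus.proj (2 * S + 1) 0, a, i)))
              (quarkEquiv (f, (Torus.proj (2 * S + 1) (Pi.single 0 (n : ℤ)), b, j)))‖) ^ s
        ∂(wilsonMeasure (fundamentalRep (Fin 3)) (reg.β k))) /
      (∫ U : GaugeConfig 4 (2 * S + 1) (Matrix.specialUnitaryGroup (Fin 3) ℂ),
        ‖(diracMatrix U fun _ : Fin 2 => reg.mcrit k + reg.a k * m / reg.Zm k).det‖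
          ∂(wilsonMeasure (fundamentalRep (Fin 3)) (reg.β k))) with hFMdef
  set Q2 : ℝ := (∫ U : GaugeConfig 4 (2 * S + 1) (Matrix.specialUnitaryGroup (Fin 3) ℂ),
      ‖(diracMatrix U fun _ : Fin 2 => reg.mcrit k + reg.a k * m / reg.Zm k).det‖ *
        (∑ a : Fin 3, ∑ i : Fin 4, ∑ b : Fin 3, ∑ j : Fin 4,
          ‖(diracMatrix U fun _ : Fin 2 => reg.mcrit k + reg.a k * m / reg.Zm k)⁻¹
              (quarkEquiv (f, (Torus.proj (2 * S + 1) 0, a, i)))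
              (quarkEquiv (f, (Torus.proj (2 * S + 1) (Pi.single 0 (n : ℤ)), b, j)))‖ ^ (2 : ℕ))
        ∂(wilsonMeasure (fundamentalRep (Fin 3)) (reg.β k))) /
      (∫ U : GaugeConfig 4 (2 * S + 1) (Matrix.specialUnitaryGroup (Fin 3) ℂ),
        ‖(diracMatrix U fun _ : Fin 2 => reg.mcrit k + reg.a k * m / reg.Zm k).det‖
          ∂(wilsonMeasure (fundamentalRep (Fin 3)) (reg.β k))) with hQ2def
  change FM ^ (2 / s) ≤ 144 * Q2 at hpt
  change c₀ * Real.exp (-(C₁ * (reg.a k * n) + p * Real.log (n + 1))) ≤ FM at hlow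
  change c₀ ^ (2 / s) / 144 * Real.exp (-(2 * C₁ / s * (reg.a k * n) + 2 * p / s * Real.log (n + 1))) ≤ Q2
  have hL0 : 0 ≤ c₀ * Real.exp (-(C₁ * (reg.a k * n) + p * Real.log (n + 1))) := by positivity
  have h2s : 0 < 2 / s := by positivity
  -- raise `c₀ e^{-(…)} ≤ E₊[X^s]` to the power `2/s` and chain with the pointwise Jensen bound
  have h1 : (c₀ * Real.exp (-(C₁ * (reg.a k * n) + p * Real.log (n + 1)))) ^ (2 / s) ≤ 144 * Q2 :=
    (Real.rpow_le_rpow hL0 hlow h2s.le).trans hpt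
  have hpow : (c₀ * Real.exp (-(C₁ * (reg.a k * n) + p * Real.log (n + 1)))) ^ (2 / s) =
      c₀ ^ (2 / s) * Real.exp (-(2 * C₁ / s * (reg.a k * n) + 2 * p / s * Real.log (n + 1))) := by
    rw [Real.mul_rpow hc₀.le (Real.exp_pos _).le, ← Real.exp_mul]
    congr 2
    ring
  rw [hpow] at h1
  calc c₀ ^ (2 / s) / 144 * Real.exp (-(2 * C₁ / s * (reg.a k * n) + 2 * p / s * Real.log (n + 1)))
      = c₀ ^ (2 / s) * Real.exp (-(2 * C₁ / s * (reg.a k * n) + 2 * p / s * Real.log (n + 1))) / 144 := by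
        ring
    _ ≤ Q2 := by
        rw [div_le_iff₀ (by norm_num : (0 : ℝ) < 144)]
        linarith [h1]

/-- **Per-rate Goldstone assembly (`N_f = 2`).**  An eventual `|det|`-weighted second-moment lower bound
`c e^{−(μ a_k n + p log(n+1))} ≤ E₊[Σ|G_f|²]` at ONE positive degenerate tuple `m_crit(k) + a_k m / Z_m(k)` (`m > 0`), on
all tori `S ≥ L_k` and separations `n ≤ S`, gives `reg.HasGoldstoneBoundAt ε` at every rate `ε > μ` (no sign condition
on `μ` or `ε`).  Verbatim the per-rate body of `stub_goldstone_of_secondMoment_two` (p135713): at two degenerate flavours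
`det D = |det D|` (`…GoldstoneWitness.det_diracMatrix_two_degenerate_eq_norm`), so `E₊[Σ|G_f|²]` is minus the honest
connected correlator of the charged pion pair `ψ̄_g γ₅ ψ_f`, `ψ̄_f γ₅ ψ_g`, `g ≠ f`
(`…GoldstoneWitness.pionCorr_eq_neg_signedQuotient`); separations `n_k ≥ ⌈a_k⁻²⌉₊` absorb the log-loss at an
intermediate rate `μ < (μ+ε)/2 < ε` (`exists_seq_nat_log_le`, `tendsto_mul_seq_atTop_of_ceil_le`), tori
`S_k := max (L_k) (n_k)`. [folklore] -/
theorem hasGoldstoneBoundAt_of_secondMomentAt_two (reg : QCDRegularisation 2) {m : ℝ} (hm : 0 < m) (f : Fin 2)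
    {μ c : ℝ} (p : ℝ) (hc : 0 < c)
    (hev : ∀ᶠ k in atTop, ∀ S : ℕ, reg.L k ≤ S → ∀ n : ℕ, n ≤ S →
      c * Real.exp (-(μ * (reg.a k * n) + p * Real.log (n + 1))) ≤
        (∫ U : GaugeConfig 4 (2 * S + 1) (Matrix.specialUnitaryGroup (Fin 3) ℂ),
            ‖(diracMatrix U fun _ : Fin 2 => reg.mcrit k + reg.a k * m / reg.Zm k).det‖ *
              (∑ a : Fin 3, ∑ i : Fin 4, ∑ b : Fin 3, ∑ j : Fin 4,
                ‖(diracMatrix U fun _ : Fin 2 => reg.mcrit k + reg.a k * m / reg.Zm k)⁻¹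
                    (quarkEquiv (f, (Torus.proj (2 * S + 1) 0, a, i)))
                    (quarkEquiv (f, (Torus.proj (2 * S + 1) (Pi.single 0 (n : ℤ)), b, j)))‖ ^ (2 : ℕ))
            ∂(wilsonMeasure (fundamentalRep (Fin 3)) (reg.β k))) /
          (∫ U : GaugeConfig 4 (2 * S + 1) (Matrix.specialUnitaryGroup (Fin 3) ℂ),
            ‖(diracMatrix U fun _ : Fin 2 => reg.mcrit k + reg.a k * m / reg.Zm k).det‖
              ∂(wilsonMeasure (fundamentalRep (Fin 3)) (reg.β k))))
    {ε : ℝ} (hμ : μ < ε) : reg.HasGoldstoneBoundAt ε := by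
  -- the other flavour
  have hsucc : ∀ f' : Fin 2, f' ≠ f' + 1 := by decide
  obtain ⟨g, hfg⟩ : ∃ g : Fin 2, f ≠ g := ⟨f + 1, hsucc f⟩
  -- an intermediate rate `μ < μ' < ε`
  set μ' : ℝ := (μ + ε) / 2 with hμ'
  have hμμ' : μ < μ' := by rw [hμ']; linarith
  have hμ'ε : μ' < ε := by rw [hμ']; linarith
  -- separations absorbing the log-loss, with diverging physical time, and the tori
  obtain ⟨n, hn⟩ := exists_seq_nat_log_le reg.a reg.a_pos hc hμμ' p
  have hdiv : Tendsto (fun k => reg.a k * n k) atTop atTop :=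
    tendsto_mul_seq_atTop_of_ceil_le reg.a_pos reg.tendsto_a fun k => (hn k).1
  refine ⟨fun _ => m, fun _ => hm, μ', c, hμ'ε, hc, 1, 1,
    pseudoscalarDensityObs 2 (Matrix.single g f (1 : ℂ)),
    pseudoscalarDensityObs 2 (Matrix.single f g (1 : ℂ)),
    fun k => max (reg.L k) (n k), n, fun k => le_max_left _ _, fun k => le_max_right _ _, hdiv, ?_⟩
  filter_upwards [hev] with k hk
  have hle := hk (max (reg.L k) (n k)) (le_max_left _ _) (n k) (le_max_right _ _)
  have hmq : (fun fl => (reg.scheme (fun _ : Fin 2 => m) 0 0).mq fl k) =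
      fun _ : Fin 2 => reg.mcrit k + reg.a k * m / reg.Zm k := by
    funext fl
    simp [QCDRegularisation.scheme_mq]
  rw [hmq, pionCorr_eq_neg_signedQuotient _ _ hfg rfl (n k), norm_neg]
  -- abbreviations at the fixed `k`
  set S : ℕ := max (reg.L k) (n k) with hS
  set mq : Fin 2 → ℝ := fun _ => reg.mcrit k + reg.a k * m / reg.Zm k with hmq_def
  set ν := wilsonMeasure (d := 4) (L := 2 * S + 1) (fundamentalRep (Fin 3)) (reg.β k) with hν
  set X : GaugeConfig 4 (2 * S + 1) (Matrix.specialUnitaryGroup (Fin 3) ℂ) → ℝ := fun U =>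
    ∑ a : Fin 3, ∑ i : Fin 4, ∑ b : Fin 3, ∑ j : Fin 4,
      ‖(diracMatrix U mq)⁻¹ (quarkEquiv (f, (Torus.proj (2 * S + 1) 0, a, i)))
        (quarkEquiv (f, (Torus.proj (2 * S + 1) (Pi.single 0 (n k : ℤ)), b, j)))‖ ^ (2 : ℕ) with hX
  -- at two degenerate flavours the signed determinant is its modulus
  have hdet : ∀ U : GaugeConfig 4 (2 * S + 1) (Matrix.specialUnitaryGroup (Fin 3) ℂ),
      (diracMatrix U mq).det = ((‖(diracMatrix U mq).det‖ : ℝ) : ℂ) := fun U =>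
    det_diracMatrix_two_degenerate_eq_norm U _
  have hnum : (∫ U, (diracMatrix U mq).det * ((X U : ℝ) : ℂ) ∂ν) =
      ((∫ U, ‖(diracMatrix U mq).det‖ * X U ∂ν : ℝ) : ℂ) := by
    rw [← integral_complex_ofReal]
    refine integral_congr_ae (Eventually.of_forall fun U => ?_)
    beta_reduce
    rw [Complex.ofReal_mul, ← hdet U]
  have hden : (∫ U, (diracMatrix U mq).det ∂ν) = ((∫ U, ‖(diracMatrix U mq).det‖ ∂ν : ℝ) : ℂ) := by
    rw [← integral_complex_ofReal]
    exact integral_congr_ae (Eventually.of_forall fun U => hdet U)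
  rw [hnum, hden, ← Complex.ofReal_div, Complex.norm_real, Real.norm_eq_abs]
  exact (hn k).2.trans (hle.trans (le_abs_self _))

/-- **Per-rate Goldstone bound at `N_f = 2` from clause (iii) at a degenerate tuple.**  If along `reg` the phase-quenched
fractional moment (exponent `0 < s ≤ 2`) of the flavour-`f` quark propagator at the degenerate bare masses
`m_crit(k) + a_k t / Z_m(k)` is bounded below by `c₀ e^{-(C₁ a_k n + p log(n+1))}` on all tori `S ≥ L_k`, eventually in `k`
(clause (iii) of the crux's package at the tuple `(t,t)`, with its constants exposed), then `reg` has the Goldstone bound at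
EVERY rate `ε` with `2C₁ < s ε`: Jensen to the second moment at rate `2C₁/s` (p135565's step), the degenerate determinant
`det D = (det D_W)² = |det D|` and the pion identity turn it into an eventual lower bound on the honest charged-pion
correlator at separations absorbing the log-loss (p135713's step).  So at `N_f = 2` the chirality stub E* is free above
`r₀ = inf_t 2C₁(t)/s(t)` and open exactly below. -/
theorem stub_hasGoldstoneBoundAt_two_of_clauseIII : ∀ reg : QCDRegularisation 2, ∀ t : ℝ, 0 < t → ∀ (f : Fin 2) (s c₀ C₁ p : ℝ), 0 < s → s ≤ 2 → 0 < c₀ → (∀ᶠ k in atTop, ∀ S : ℕ, reg.L k ≤ S → ∀ n : ℕ, n ≤ S → c₀ * Real.exp (-(C₁ * (reg.a k * n) + p * Real.log (n + 1))) ≤ (∫ U : GaugeConfig 4 (2 * S + 1) (Matrix.specialUnitaryGroup (Fin 3) ℂ), ‖(diracMatrix U fun _ : Fin 2 => reg.mcrit k + reg.a k * t / reg.Zm k).det‖ * (∑ a : Fin 3, ∑ i : Fin 4, ∑ b : Fin 3, ∑ j : Fin 4, ‖(diracMatrix U fun _ : Fin 2 => reg.mcrit k + reg.a k * t / reg.Zm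 k)⁻¹ (quarkEquiv (f, (Torus.proj (2 * S + 1) 0, a, i))) (quarkEquiv (f, (Torus.proj (2 * S + 1) (Pi.single 0 (n : ℤ)), b, j)))‖) ^ s ∂(wilsonMeasure (fundamentalRep (Fin 3)) (reg.β k))) / (∫ U : GaugeConfig 4 (2 * S + 1) (Matrix.specialUnitaryGroup (Fin 3) ℂ), ‖(diracMatrix U fun _ : Fin 2 => reg.mcrit k + reg.a k * t / reg.Zm k).det‖ ∂(wilsonMeasure (fundamentalRep (Fin 3)) (reg.β k)))) → ∀ ε : ℝ, 2 * C₁ < s * ε → reg.HasGoldstoneBoundAt ε := by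
  intro reg t ht f s c₀ C₁ p hs hs2 hc₀ hev ε hε
  -- the second-moment bound has rate `2C₁/s < ε` and constant `c₀^{2/s}/144 > 0`
  have hμ : 2 * C₁ / s < ε := by
    rw [div_lt_iff₀ hs]
    linarith [mul_comm s ε]
  have hc : 0 < c₀ ^ (2 / s) / 144 := by positivity
  exact hasGoldstoneBoundAt_of_secondMomentAt_two reg ht f (2 * p / s) hc
    (secondMomentAt_of_clauseIIIAt_two reg t f C₁ p hs hs2 hc₀ hev) hμ

end Summit.QuantumFields.QCD.Theorems.StronglyChiralSubsequence

end
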